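import Mathlib.Analysis.InnerProductSpace.PiL2
import Literature.Geometry.DiscreteGeometry.KissingPatterns
import Literature.MathematicalPhysics.StatisticalMechanics.BarlowStacking
import HarnessLib

/-!
# Line `registered` (crux `RobustBarlowTemplate`, stmt-AtomisticToContinuum-12088): vocabulary

Definitions (D-0016: reviewed; proofs live in the sibling files
`HullExactificationCascadeRobustBarlowTemplate<Stub>.lean`) of the line `Lines/birth.lean` of the
crux `Summit.AtomisticToContinuum.Crystallization.Theses.HullExactificationCascade.RobustBarlowTemplate`
(shared with route `DisclinationRation`).  They are the INLINED predicates of the crux, named, and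
unfold definitionally to the crux text (the skeleton's `RobustBarlowTemplate_of` feeds the stubs to
the crux by `intro`/`exact`); identical text to the registered skeleton
`Cruxes/RobustBarlowTemplate/Lines/birth.lean` (namespace `…Cruxes.RobustBarlowTemplate.Birth`).

* `nnd S y` — nearest-neighbour distance `d(y) = sInf {dist z y : z ∈ S \ {y}}` (the crux's `let d`);
* `shell S y` — the first shell `{z ∈ S | z ≠ y ∧ dist z y < 13/10 · d(y)}` (the crux's `let T`);
* `Good S y` — the rescaled recentred shell is `1/20`-matched after a linear isometry to the FCC
  or to the HCP kissing pattern (the crux's pointwise hypothesis, verbatim);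
* `Sep δ S` — `S` is `δ`-separated (the crux's hypothesis, verbatim);
* `Recip S` — reciprocity of the shell relation with comparable scales (conclusion of
  `stub_reciprocity`);
* `idealStacking s = barlowStacking 1 √(2/3) s` — the model of the crux's conclusion;
* `LocSim s Φ` — `Φ` is `1/20`-close to a similarity on every unit cluster of the model (the crux's
  conclusion about `Φ`, verbatim);
* `ShellClosed S s Φ` — the `S`-shell of every template point consists of template points.

All `[folklore]` (standard notions, specialised to this crux).
-/

noncomputable section

namespace Summit.AtomisticToContinuum.Crystallization.Theorems.HullExactificationCascadeRobustBarlowTemplate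

open Literature.MathematicalPhysics.StatisticalMechanics Literature.Geometry.DiscreteGeometry

/-- Euclidean `3`-space. -/
local notation "E3" => EuclideanSpace ℝ (Fin 3)

/-- Nearest-neighbour distance `d(y) = inf {dist z y : z ∈ S, z ≠ y}` (the crux's `let d`).
[folklore] -/
def nnd (S : Set E3) (y : E3) : ℝ := sInf ((fun z => dist z y) '' (S \ {y}))

/-- The first shell of `y` in `S`: the other points of `S` within `13/10 · d(y)` (the crux's
`let T`). [folklore] -/
def shell (S : Set E3) (y : E3) : Set E3 :=
  {z : E3 | z ∈ S ∧ z ≠ y ∧ dist z y < 13 / 10 * nnd S y}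

/-- `y` is `1/20`-good in `S`: its rescaled, recentred shell is `1/20`-matched, after a linear
isometry, to the FCC or to the HCP kissing pattern (verbatim the crux's pointwise hypothesis).
[folklore] -/
def Good (S : Set E3) (y : E3) : Prop :=
  ∃ A : E3 →ₗᵢ[ℝ] E3,
    (∃ e : ↥(shell S y) ≃ ↥fccKissingPattern, ∀ t : ↥(shell S y),
        dist ((nnd S y)⁻¹ • ((t : E3) - y)) (A ((e t : ↥fccKissingPattern) : E3)) ≤ 1 / 20) ∨
    (∃ e : ↥(shell S y) ≃ ↥hcpKissingPattern, ∀ t : ↥(shell S y),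
        dist ((nnd S y)⁻¹ • ((t : E3) - y)) (A ((e t : ↥hcpKissingPattern) : E3)) ≤ 1 / 20)

/-- `S` is `δ`-separated (verbatim the crux's hypothesis). [folklore] -/
def Sep (δ : ℝ) (S : Set E3) : Prop := ∀ y ∈ S, ∀ z ∈ S, y ≠ z → δ ≤ dist y z

/-- RECIPROCITY of the shell relation with comparable scales (conclusion of `stub_reciprocity`).
[folklore] -/
def Recip (S : Set E3) : Prop :=
  ∀ y ∈ S, ∀ z ∈ shell S y, y ∈ shell S z ∧ 9 / 10 * nnd S y ≤ nnd S z ∧ nnd S z ≤ 10 / 9 * nnd S y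

/-- The ideal Barlow stacking of the crux's conclusion: in-layer spacing `1`, layer spacing
`√(2/3)`, label walk `s`. [folklore] -/
def idealStacking (s : ℤ → ℤ) : Set E3 := barlowStacking 1 (Real.sqrt (2 / 3)) s

/-- `Φ` is `1/20`-close to a similarity `q ↦ Φ p + l_p • A_p (q - p)` on every unit cluster of the
ideal stacking (verbatim the crux's conclusion about `Φ`). [folklore] -/
def LocSim (s : ℤ → ℤ) (Φ : E3 → E3) : Prop :=
  ∀ p ∈ idealStacking s, ∃ A : E3 →ₗᵢ[ℝ] E3, ∃ l : ℝ, 0 < l ∧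
    ∀ q ∈ idealStacking s, dist q p ≤ 1 → dist (Φ q) (Φ p + l • A (q - p)) ≤ 1 / 20 * l

/-- The template `Φ '' idealStacking s` is SHELL-CLOSED in `S`: the `S`-shell of every template
point consists of template points. [folklore] -/
def ShellClosed (S : Set E3) (s : ℤ → ℤ) (Φ : E3 → E3) : Prop :=
  ∀ p ∈ idealStacking s, shell S (Φ p) ⊆ Φ '' idealStacking s

/-- Anchor (registered sub-goal of stmt-AtomisticToContinuum-12088): the shell of `y` lies in `S`
and avoids `y`. [folklore] -/
theorem shell_subset : ∀ (S : Set E3) (y : E3), shell S y ⊆ S \ {y} := by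
  intro S y z hz
  exact ⟨hz.1, fun h => hz.2.1 (Set.mem_singleton_iff.1 h)⟩

end Summit.AtomisticToContinuum.Crystallization.Theorems.HullExactificationCascadeRobustBarlowTemplate

end
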